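import Mathlib
import Literature.MathematicalPhysics.QuantumFieldTheory.Balaban1983to89.Beta.EffectiveKernel

/-!
# Beta / EffectiveKernelCoercive — the block-spin variational principle for `K_eff` and its UNIFORM COERCIVITY
`min(a/(8d), 1/2) · (−Δ₁) ≤ K_eff ≤ a` on the unit torus, for every mesh, every volume, every `a > 0`

HONEST FRAMING (verbatim, page 1 of everything this cell writes): discharging `BetaPertH` makes Bałaban's UV
stability UNCONDITIONAL — a real constructive-QFT result; it is NOT the continuum limit and NOT the Clay problem.
Gloss (BETA-SPEC v1.9b l. 17–18, G-ref2-14 (a) / G-ref2-20 (a)): «UNCONDITIONAL» in [Balaban1989LargeFieldII] (B16)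
p. 355's interval-hypothesis sense ONLY (`FlowStepRuns.p355Unconditional_of_partialSums` keeps `hnodes`); the located
leaves G-adv3-2 (left inequality of (0.1)/(2.50), d = 4), G-adv3-1 (U2 transfer of B14 Cor. 3's lower bound) and
`SecondExpLeaf` REMAIN.  THIS MODULE discharges nothing of that: it is a Mathlib-elementary certificate about the SAME
scalar toy operator as `Beta/EffectiveKernel` (module 1 of this seat); nothing printed by Bałaban or King is asserted
and no hypothesis is a quotation.

THE OBJECTS (all from the imported modules): fine torus `T_η = Tor (fine (n+1) M)` (mesh `η = 1/(n+1)`), unit torus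
`Tor M`, `H = torusOp n M a = lap c + (a/(n+1)^d)·indᵀ ind` (`c = (n+1)²` on nearest neighbours), `G₀ = G0 n M a = H⁻¹`,
the block indicator `ind` (`Q = (n+1)^{−d}·ind` = block averaging), and `K_eff = Keff n M a = a·1 − (a²/(n+1)^d)·ind G₀ indᵀ`.

WHAT IS PROVED ([folklore] throughout = OUR elementary theorems about OUR objects).
* §1 GEOMETRY of blocks under unit shifts: `bpt_add_unitVec` (the chart of the block `b + e_μ` is the chart of `b`
  translated by `(n+1)` fine steps), `ind_mulVec_eq` (`(ind g)(b) = Σ_j g(bpt b j)`), `sum_fine_eq_sum_blocks`,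
  `sum_fine_shift`, `telescope` (a difference over `N` fine steps is a sum of `N` bond differences).
* §2 the torus DIRICHLET FORM `dirichletT N χ = Σ_x Σ_μ (χ(x + e_μ) − χ(x))²` (`= BlockPoincare.dirichlet` of the bond
  system of `TorusG0Decay`, `dirichletT_eq_dirichlet`) with `dirichletT_le_norm` (`≤ 4d‖χ‖²`), `dirichletT_add_le`,
  `dirichletT_smul`, and `eq_of_dirichletT_eq_zero` (zero Dirichlet form ⇒ constant: the unit vectors generate `Tor N`,
  `eq_sum_unitVec`); (D-a) `lap_form_ge_dirichletT`: `(n+1)²·dirichletT_{T_η} g ≤ ⟨g, lap c g⟩`; and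
  (D-b) **THE AVERAGING INEQUALITY** `dirichletT_ind_le`: `dirichletT_M (ind g) ≤ (n+1)^d (n+1)² · dirichletT_{T_η} g`
  — block sums create no Dirichlet energy (telescoping along `μ`, Cauchy–Schwarz over the `(n+1)^d (n+1)` fine bond
  differences behind one unit difference, translation invariance: each fine bond is used `(n+1)` times); equivalently
  `E₁(Q g) ≤ (n+1)^{−d}⟨g, lap_c g⟩`, the `η`-scaled fine Dirichlet energy.
* §3 **THE VARIATIONAL PRINCIPLE OF THE GAUSSIAN BLOCK-SPIN TRANSFORMATION**: for every `ψ : Tor M → ℝ` and EVERY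
  fine configuration `g`,  `⟨ψ, K_eff ψ⟩ ≤ a‖ψ − Q g‖² + (n+1)^{−d}⟨g, lap_c g⟩`  (`Keff_form_le_energy`), with EQUALITY at
  the minimiser `g⋆ = a G₀ indᵀ ψ` (`Keff_form_eq_energy`): `½⟨ψ,K_eff ψ⟩ = min_g [½ fine kinetic energy + (a/2)‖ψ − Qg‖²]`
  — the defining property of the effective action of a Gaussian under `ψ = Qf +` noise, here a THEOREM about `Keff`
  (module 1 defined `Keff` as the Schur complement; the identity is `energy_expand` + `H(aG₀indᵀψ) = a indᵀψ` +
  positivity of `⟨(g − g⋆), H(g − g⋆)⟩`).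
* §4 **UNIFORM COERCIVITY** `Keff_form_ge_dirichletT`: for every mesh `η = 1/(n+1)`, every period vector with
  `(n+1)M_μ ≥ 3`, every `a > 0` and every `ψ`,
      `min(a/(8d), 1/2) · Σ_{b,μ} (ψ(b + e_μ) − ψ(b))² ≤ ⟨ψ, K_eff ψ⟩`;
  with module 1's `Keff_form_le` (`⟨ψ,K_eff ψ⟩ ≤ a‖ψ‖²`, restated as `Keff_form_two_sided`): the effective unit-lattice
  kinetic term is bounded above and is bounded BELOW by an `η`- and volume-free multiple of the unit Laplacian `−Δ₁`
  (proof: `E₁(ψ) ≤ 2E₁(ψ − Qg⋆) + 2E₁(Qg⋆) ≤ 8d‖ψ − Qg⋆‖² + 2(n+1)^{−d}⟨g⋆, lap_c g⋆⟩` by §2, then §3's equality).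
  Corollary `Keff_ker_const`: `⟨ψ, K_eff ψ⟩ = 0 ⇒ ψ` constant — with module 1's `Keff_mulVec_one` (`K_eff 1 = 0`) this is
  `ker K_eff = constants` EXACTLY (item (iv) left open in module 1's header), i.e. `K_eff` has the zero mode of a
  massless kinetic term and no other.
WHY IT MATTERS FOR THE CELL (located, modest): the (T2)/(I2) rows of AN5.md control `K_eff` from ABOVE (row moments);
this module is the complementary LOWER bound «`K_eff` is uniformly elliptic on the unit lattice», the scalar-model
analogue of the positivity / lower bounds for effective actions that every block-spin RG step needs before the next
integration.  It is stated and proved for OUR scalar site-averaged `Keff` only.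

WHAT IT DOES NOT GIVE (located, not claimed).  (i) scalar `U = 1` SITE-averaged model only (no bond / covariant
`Δ_k(U)`, no gauge fixing); (ii) nothing about `Π_{k+1}`, `β`, its sign, `κ = kappaBal` (G-beta-4, THE HEART), nothing of
`BetaPertH`; (iii) no comparison `⟨ψ,K_eff ψ⟩ ≤ C·E₁(ψ)` with an `η`-free `C` (true, via a multilinear interpolant; not
needed and not proved — only `≤ a‖ψ‖²`); (iv) no infinite-volume object.  CONTEXT ONLY (printed TYPE, never used):
uniform-in-`k` bounds for effective unit-lattice operators — King, *The U(1) Higgs model. I*, Commun. Math. Phys. 102 (1986)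
649–677, Prop. 3.10 (3.91) p. 669 [King1986] (LOCATOR CORRECTED, docstring only, b2b-balaban-beta-an5 gen 15 after asym1's NOTE
«KING 1986 LOCATOR SLIP»: gen 4 printed Part II's volume «103» and a non-existent bib key `King1986U1Higgs3dI`; re-checked on
the held text layer p. 669; nothing was or is cited as a fact); the operator `−Δ^η + aQ*Q` is that of Bałaban, Commun. Math.
Phys. 95 (1984) (1.18) p. 20
[Balaban1984PropagatorsI].  Devices: Cauchy–Schwarz (`sq_sum_le_card_mul_sum_sq`), telescoping (`Finset.sum_range_sub`),
`BlockPoincare.lap_form_ge_dirichlet` [folklore].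
Cell records: AN5.md §8 (gen-4 ledger), MISSING-B12 §12.2 (i).  Unit `b2b-balaban-beta-an5-g4` (DEDICATED β sub-cell
row BETA-an5, gen 4; journal claim BETA-an5-KEFF-DECAY); staged byte-identically under `HOME/lean/BalabanYm4/`.
Value = kernel certificate of a located structural step for a toy operator, NOT summit progress.
-/

open Finset Matrix

namespace Literature.MathematicalPhysics.QuantumFieldTheory.Balaban1983to89.Beta.EffectiveKernelCoercive

noncomputable section

open B5Prop11Plancherel (Tor fine unitVec)
open B5Block118 (bpt tstep tstep_zero tstep_succ up_add up_unitVec)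
open CombesThomasForm (lap lap_form)
open BlockPoincare (dirichlet lap_form_ge_dirichlet)
open TorusG0Decay (torusOp coupling coupling_symm coupling_nonneg coupling_bond src tgt bond_injective bond_anti
  unitVec_same unitVec_ne blockOf_chart chart_injective filter_block_eq_image)
open TorusG0Kernel (G0 torusOp_transpose torusOp_mulVec_G0)
open EffectiveKernel (ind ind_apply Keff torusOp_form_eq lap_form_nonneg Keff_form_nonneg Keff_form_le)

/-! ## §2 (first half)  The torus Dirichlet form on `Tor N` -/

section TorusDirichlet

variable {d : ℕ} (N : Fin d → ℕ) [hN : ∀ μ, NeZero (N μ)]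

/-- the nearest-neighbour Dirichlet form of the torus `Tor N`: `E(χ) = Σ_x Σ_μ (χ(x + e_μ) − χ(x))²`. [folklore] -/
def dirichletT (χ : Tor N → ℝ) : ℝ := ∑ x : Tor N, ∑ μ : Fin d, (χ (x + unitVec N μ) - χ x) ^ 2

/-- dictionary: `dirichletT N` is `BlockPoincare.dirichlet` of the bond system `(src, tgt)` of `TorusG0Decay`. [folklore] -/
theorem dirichletT_eq_dirichlet (χ : Tor N → ℝ) : dirichletT N χ = dirichlet (src N) (tgt N) χ := by
  rw [dirichlet, Fintype.sum_prod_type]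
  rfl

/-- `E(χ) ≥ 0`. [folklore] -/
theorem dirichletT_nonneg (χ : Tor N → ℝ) : 0 ≤ dirichletT N χ :=
  Finset.sum_nonneg fun _ _ => Finset.sum_nonneg fun _ _ => sq_nonneg _

/-- `E(c·χ) = c² E(χ)`. [folklore] -/
theorem dirichletT_smul (c : ℝ) (χ : Tor N → ℝ) : dirichletT N (c • χ) = c ^ 2 * dirichletT N χ := by
  simp only [dirichletT, Finset.mul_sum, Pi.smul_apply, smul_eq_mul]
  exact Finset.sum_congr rfl fun x _ => Finset.sum_congr rfl fun μ _ => by ring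

/-- `E(χ₁ + χ₂) ≤ 2E(χ₁) + 2E(χ₂)`. [folklore] -/
theorem dirichletT_add_le (χ₁ χ₂ : Tor N → ℝ) :
    dirichletT N (χ₁ + χ₂) ≤ 2 * dirichletT N χ₁ + 2 * dirichletT N χ₂ := by
  simp only [dirichletT, Finset.mul_sum, ← Finset.sum_add_distrib, Pi.add_apply]
  refine Finset.sum_le_sum fun x _ => Finset.sum_le_sum fun μ _ => ?_
  nlinarith [sq_nonneg ((χ₁ (x + unitVec N μ) - χ₁ x) - (χ₂ (x + unitVec N μ) - χ₂ x))]

/-- `E(χ) ≤ 4d ‖χ‖²` (the unit Laplacian is bounded by `4d`). [folklore] -/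
theorem dirichletT_le_norm (χ : Tor N → ℝ) : dirichletT N χ ≤ 4 * d * (χ ⬝ᵥ χ) := by
  have hpt : ∀ (x : Tor N) (μ : Fin d),
      (χ (x + unitVec N μ) - χ x) ^ 2 ≤ 2 * χ (x + unitVec N μ) ^ 2 + 2 * χ x ^ 2 :=
    fun x μ => by nlinarith [sq_nonneg (χ (x + unitVec N μ) + χ x)]
  have hshift : ∀ μ : Fin d, ∑ x : Tor N, χ (x + unitVec N μ) ^ 2 = ∑ x : Tor N, χ x ^ 2 :=
    fun μ => Fintype.sum_equiv (Equiv.addRight (unitVec N μ)) _ _ fun _ => rfl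
  have hn : χ ⬝ᵥ χ = ∑ x, χ x ^ 2 := Finset.sum_congr rfl fun x _ => by ring
  calc dirichletT N χ ≤ ∑ x : Tor N, ∑ μ : Fin d, (2 * χ (x + unitVec N μ) ^ 2 + 2 * χ x ^ 2) :=
        Finset.sum_le_sum fun x _ => Finset.sum_le_sum fun μ _ => hpt x μ
    _ = ∑ μ : Fin d, (2 * ∑ x : Tor N, χ (x + unitVec N μ) ^ 2 + 2 * ∑ x : Tor N, χ x ^ 2) := by
        rw [Finset.sum_comm]
        simp only [Finset.sum_add_distrib, Finset.mul_sum]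
    _ = 4 * d * (χ ⬝ᵥ χ) := by
        simp only [hshift, hn]
        rw [Finset.sum_const, Finset.card_univ, Fintype.card_fin, nsmul_eq_mul]
        ring

/-- every torus vector is a natural combination of the unit vectors: `t = Σ_μ v(t_μ)·e_μ`. [folklore] -/
theorem eq_sum_unitVec (t : Tor N) : t = ∑ μ : Fin d, (t μ).val • unitVec N μ := by
  funext ν
  rw [Finset.sum_apply, Finset.sum_eq_single ν]
  · rw [Pi.smul_apply, unitVec_same, Nat.smul_one_eq_cast, ZMod.natCast_zmod_val]
  · intro μ _ hμ
    rw [Pi.smul_apply, unitVec_ne N (Ne.symm hμ), smul_zero]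
  · intro h
    exact absurd (Finset.mem_univ ν) h

/-- **zero Dirichlet form ⇒ constant** (the torus is connected through unit steps). [folklore] -/
theorem eq_of_dirichletT_eq_zero (χ : Tor N → ℝ) (h : dirichletT N χ = 0) (x y : Tor N) : χ x = χ y := by
  -- one step
  have hstep : ∀ (z : Tor N) (μ : Fin d), χ (z + unitVec N μ) = χ z := by
    intro z μ
    have hz := (Finset.sum_eq_zero_iff_of_nonneg fun z _ =>
      Finset.sum_nonneg fun μ _ => sq_nonneg (χ (z + unitVec N μ) - χ z)).1 h z (Finset.mem_univ z)
    have hzμ := (Finset.sum_eq_zero_iff_of_nonneg fun μ _ =>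
      sq_nonneg (χ (z + unitVec N μ) - χ z)).1 hz μ (Finset.mem_univ μ)
    exact sub_eq_zero.1 ((pow_eq_zero_iff two_ne_zero).1 hzμ)
  -- `k` steps
  have hk : ∀ (k : ℕ) (z : Tor N) (μ : Fin d), χ (z + k • unitVec N μ) = χ z := by
    intro k
    induction k with
    | zero => intro z μ; rw [zero_smul, add_zero]
    | succ k ih => intro z μ; rw [succ_nsmul, ← add_assoc, hstep, ih]
  -- finitely many directions
  have hs : ∀ (s : Finset (Fin d)) (c : Fin d → ℕ) (z : Tor N), χ (z + ∑ μ ∈ s, c μ • unitVec N μ) = χ z := by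
    intro s c
    induction s using Finset.induction_on with
    | empty => intro z; rw [Finset.sum_empty, add_zero]
    | insert i s hi ih =>
        intro z
        rw [Finset.sum_insert hi, add_comm (c i • unitVec N i), ← add_assoc, hk, ih]
  have hy : y = x + ∑ μ : Fin d, ((y - x) μ).val • unitVec N μ := by
    rw [← eq_sum_unitVec N (y - x), add_sub_cancel]
  rw [hy, hs]

end TorusDirichlet

/-! ## §1  Geometry of blocks under unit shifts; sums -/

variable {d : ℕ} (n : ℕ) (M : Fin d → ℕ) [hM : ∀ μ, NeZero (M μ)]

omit hM in
/-- the chart of the shifted block: `bpt (b + e_μ) j = bpt b j + (n+1)·ê_μ`. [folklore] -/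
theorem bpt_add_unitVec (b : Tor M) (j : Fin d → Fin (n + 1)) (μ : Fin d) :
    bpt (n + 1) M (b + unitVec M μ) j = bpt (n + 1) M b j + tstep (fine (n + 1) M) μ (n + 1) := by
  show B5Block118.up (n + 1) M (b + unitVec M μ) + B5Block118.iota (n + 1) M j = _
  rw [up_add, up_unitVec]
  show _ = B5Block118.up (n + 1) M b + B5Block118.iota (n + 1) M j + _
  abel

/-- sums over the fine torus, block by block (real-valued `B5Blocks16.sum_blocks`). [folklore] -/
theorem sum_fine_eq_sum_blocks (F : Tor (fine (n + 1) M) → ℝ) :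
    ∑ x, F x = ∑ b : Tor M, ∑ j : Fin d → Fin (n + 1), F (bpt (n + 1) M b j) := by
  rw [← (B5Blocks16.bpt_bijective (n + 1) M).sum_comp F, Fintype.sum_prod_type]

/-- `(ind g)(b) = Σ_j g(bpt b j)`: the block sum read in the chart. [folklore] -/
theorem ind_mulVec_eq (g : Tor (fine (n + 1) M) → ℝ) (b : Tor M) :
    (ind n M).mulVec g b = ∑ j : Fin d → Fin (n + 1), g (bpt (n + 1) M b j) := by
  have h1 : (ind n M).mulVec g b
      = ∑ x ∈ univ.filter (fun x => B5Blocks16.blockOf (n + 1) M x = b), g x := by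
    rw [Finset.sum_filter]
    simp only [mulVec, dotProduct, ind_apply]
    exact Finset.sum_congr rfl fun x _ => by split_ifs <;> simp
  rw [h1, filter_block_eq_image n M b, Finset.sum_image fun j _ j' _ h => chart_injective n M b h]

/-- translation invariance of fine sums. [folklore] -/
theorem sum_fine_shift (F : Tor (fine (n + 1) M) → ℝ) (t : Tor (fine (n + 1) M)) :
    ∑ x, F (x + t) = ∑ x, F x :=
  Fintype.sum_equiv (Equiv.addRight t) _ _ fun _ => rfl

omit hM in
/-- telescoping along `μ`: `g(x + N ê_μ) − g(x) = Σ_{i<N} (g(x + iê_μ + ê_μ) − g(x + iê_μ))`. [folklore] -/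
theorem telescope (g : Tor (fine (n + 1) M) → ℝ) (x : Tor (fine (n + 1) M)) (μ : Fin d) (N : ℕ) :
    g (x + tstep (fine (n + 1) M) μ N) - g x
      = ∑ i ∈ range N, (g (x + tstep (fine (n + 1) M) μ i + unitVec (fine (n + 1) M) μ)
          - g (x + tstep (fine (n + 1) M) μ i)) := by
  have h : ∑ i ∈ range N, (g (x + tstep (fine (n + 1) M) μ (i + 1)) - g (x + tstep (fine (n + 1) M) μ i))
      = g (x + tstep (fine (n + 1) M) μ N) - g (x + tstep (fine (n + 1) M) μ 0) :=
    Finset.sum_range_sub (fun i => g (x + tstep (fine (n + 1) M) μ i)) N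
  rw [tstep_zero, add_zero] at h
  rw [← h]
  refine Finset.sum_congr rfl fun i _ => ?_
  rw [tstep_succ, add_assoc]

/-- Cauchy–Schwarz for a double sum: `(Σ_{x,y} u)² ≤ |s||t| Σ_{x,y} u²`. [folklore] -/
theorem sq_sum_sum_le {α β : Type*} (s : Finset α) (t : Finset β) (u : α → β → ℝ) :
    (∑ x ∈ s, ∑ y ∈ t, u x y) ^ 2 ≤ ((s.card : ℝ) * t.card) * ∑ x ∈ s, ∑ y ∈ t, u x y ^ 2 := by
  have h := sq_sum_le_card_mul_sum_sq (s := s ×ˢ t) (f := fun p : α × β => u p.1 p.2)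
  simp only [Finset.sum_product, Finset.card_product, Nat.cast_mul] at h
  exact h

/-! ## §2 (second half)  Fine energy vs `lap c`; the averaging inequality -/

/-- (D-a) `(n+1)² · E_{T_η}(g) ≤ ⟨g, lap_c g⟩` (`c = (n+1)²` on every bond; periods `≥ 3` so that bonds are listed
once). [folklore] -/
theorem lap_form_ge_dirichletT (h3 : ∀ μ, 3 ≤ fine (n + 1) M μ) (g : Tor (fine (n + 1) M) → ℝ) :
    ((n : ℝ) + 1) ^ 2 * dirichletT (fine (n + 1) M) g
      ≤ g ⬝ᵥ (lap (coupling (fine (n + 1) M) (((n : ℝ) + 1) ^ 2))).mulVec g := by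
  have h2 : ∀ μ, 2 ≤ fine (n + 1) M μ := fun μ => (by norm_num : 2 ≤ 3).trans (h3 μ)
  have hγ0 : (0 : ℝ) ≤ ((n : ℝ) + 1) ^ 2 := by positivity
  have h := lap_form_ge_dirichlet (coupling (fine (n + 1) M) (((n : ℝ) + 1) ^ 2)) (coupling_symm _ _)
    (coupling_nonneg _ hγ0) (src (fine (n + 1) M)) (tgt (fine (n + 1) M)) (((n : ℝ) + 1) ^ 2)
    (fun k => (coupling_bond (fine (n + 1) M) _ k.1 k.2).ge) (bond_injective _ h2) (bond_anti _ h3) g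
  rw [lap_form _ (coupling_symm _ _), dirichletT_eq_dirichlet, dirichlet]
  linarith

/-- (D-b) **THE AVERAGING INEQUALITY**: `E_M(ind g) ≤ (n+1)^d (n+1)² · E_{T_η}(g)` — block sums do not create
Dirichlet energy.  One unit difference of block sums is the sum of the `(n+1)^d (n+1)` fine bond differences swept when
the block is translated by `(n+1)` fine steps; Cauchy–Schwarz, then each fine bond is counted `(n+1)` times. [folklore] -/
theorem dirichletT_ind_le (g : Tor (fine (n + 1) M) → ℝ) :
    dirichletT M ((ind n M).mulVec g)
      ≤ ((n : ℝ) + 1) ^ d * ((n : ℝ) + 1) ^ 2 * dirichletT (fine (n + 1) M) g := by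
  -- (1) the increment of a block sum is a double sum of fine bond differences
  have hincr : ∀ (b : Tor M) (μ : Fin d),
      (ind n M).mulVec g (b + unitVec M μ) - (ind n M).mulVec g b
        = ∑ j : Fin d → Fin (n + 1), ∑ i ∈ range (n + 1),
            (g (bpt (n + 1) M b j + tstep (fine (n + 1) M) μ i + unitVec (fine (n + 1) M) μ)
              - g (bpt (n + 1) M b j + tstep (fine (n + 1) M) μ i)) := by
    intro b μ
    rw [ind_mulVec_eq, ind_mulVec_eq, ← Finset.sum_sub_distrib]
    refine Finset.sum_congr rfl fun j _ => ?_
    rw [bpt_add_unitVec, telescope]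
  -- (2) Cauchy–Schwarz over the `(n+1)^d (n+1)` terms
  have hcard : ((univ : Finset (Fin d → Fin (n + 1))).card : ℝ) * ((range (n + 1)).card : ℝ)
      = ((n : ℝ) + 1) ^ d * ((n : ℝ) + 1) := by
    rw [Finset.card_univ, Fintype.card_fun, Fintype.card_fin, Fintype.card_fin, Finset.card_range]
    push_cast
    ring
  have hCS : ∀ (b : Tor M) (μ : Fin d),
      ((ind n M).mulVec g (b + unitVec M μ) - (ind n M).mulVec g b) ^ 2
        ≤ (((n : ℝ) + 1) ^ d * ((n : ℝ) + 1)) * ∑ j : Fin d → Fin (n + 1), ∑ i ∈ range (n + 1),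
            (g (bpt (n + 1) M b j + tstep (fine (n + 1) M) μ i + unitVec (fine (n + 1) M) μ)
              - g (bpt (n + 1) M b j + tstep (fine (n + 1) M) μ i)) ^ 2 := by
    intro b μ
    rw [hincr, ← hcard]
    exact sq_sum_sum_le _ _ _
  -- (3) after summing over the blocks, the shifted chart points sweep the whole fine torus
  have hshift : ∀ (μ : Fin d) (i : ℕ),
      ∑ b : Tor M, ∑ j : Fin d → Fin (n + 1),
          (g (bpt (n + 1) M b j + tstep (fine (n + 1) M) μ i + unitVec (fine (n + 1) M) μ)
            - g (bpt (n + 1) M b j + tstep (fine (n + 1) M) μ i)) ^ 2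
        = ∑ x : Tor (fine (n + 1) M), (g (x + unitVec (fine (n + 1) M) μ) - g x) ^ 2 := by
    intro μ i
    rw [← sum_fine_eq_sum_blocks n M (fun x => (g (x + tstep (fine (n + 1) M) μ i + unitVec (fine (n + 1) M) μ)
      - g (x + tstep (fine (n + 1) M) μ i)) ^ 2)]
    exact sum_fine_shift n M (fun x => (g (x + unitVec (fine (n + 1) M) μ) - g x) ^ 2)
      (tstep (fine (n + 1) M) μ i)
  -- (4) the chain
  calc dirichletT M ((ind n M).mulVec g)
      = ∑ b : Tor M, ∑ μ : Fin d, ((ind n M).mulVec g (b + unitVec M μ) - (ind n M).mulVec g b) ^ 2 := rfl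
    _ ≤ ∑ b : Tor M, ∑ μ : Fin d,
          (((n : ℝ) + 1) ^ d * ((n : ℝ) + 1)) * ∑ j : Fin d → Fin (n + 1), ∑ i ∈ range (n + 1),
            (g (bpt (n + 1) M b j + tstep (fine (n + 1) M) μ i + unitVec (fine (n + 1) M) μ)
              - g (bpt (n + 1) M b j + tstep (fine (n + 1) M) μ i)) ^ 2 :=
        Finset.sum_le_sum fun b _ => Finset.sum_le_sum fun μ _ => hCS b μ
    _ = (((n : ℝ) + 1) ^ d * ((n : ℝ) + 1)) * ∑ μ : Fin d, ∑ i ∈ range (n + 1),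
          ∑ b : Tor M, ∑ j : Fin d → Fin (n + 1),
            (g (bpt (n + 1) M b j + tstep (fine (n + 1) M) μ i + unitVec (fine (n + 1) M) μ)
              - g (bpt (n + 1) M b j + tstep (fine (n + 1) M) μ i)) ^ 2 := by
        rw [Finset.sum_comm]
        simp only [← Finset.mul_sum]
        congr 1
        refine Finset.sum_congr rfl fun μ _ => ?_
        calc ∑ b : Tor M, ∑ j : Fin d → Fin (n + 1), ∑ i ∈ range (n + 1),
              (g (bpt (n + 1) M b j + tstep (fine (n + 1) M) μ i + unitVec (fine (n + 1) M) μ)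
                - g (bpt (n + 1) M b j + tstep (fine (n + 1) M) μ i)) ^ 2
            = ∑ b : Tor M, ∑ i ∈ range (n + 1), ∑ j : Fin d → Fin (n + 1),
                (g (bpt (n + 1) M b j + tstep (fine (n + 1) M) μ i + unitVec (fine (n + 1) M) μ)
                  - g (bpt (n + 1) M b j + tstep (fine (n + 1) M) μ i)) ^ 2 :=
              Finset.sum_congr rfl fun b _ => Finset.sum_comm
          _ = _ := Finset.sum_comm
    _ = (((n : ℝ) + 1) ^ d * ((n : ℝ) + 1))
          * ∑ μ : Fin d, ∑ i ∈ range (n + 1), ∑ x : Tor (fine (n + 1) M), (g (x + unitVec (fine (n + 1) M) μ) - g x) ^ 2 := by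
        simp only [hshift]
    _ = (((n : ℝ) + 1) ^ d * ((n : ℝ) + 1))
          * (((n : ℝ) + 1) * ∑ x : Tor (fine (n + 1) M), ∑ μ : Fin d, (g (x + unitVec (fine (n + 1) M) μ) - g x) ^ 2) := by
        congr 1
        rw [Finset.sum_comm]
        simp only [Finset.sum_const, Finset.card_range, nsmul_eq_mul]
        push_cast
        rw [Finset.sum_comm]
    _ = ((n : ℝ) + 1) ^ d * ((n : ℝ) + 1) ^ 2 * dirichletT (fine (n + 1) M) g := by
        rw [dirichletT]; ring

/-! ## §3  The block-spin variational principle for `K_eff` -/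

/-- expansion of the block-spin functional: for every `ψ`, `g`,
`a‖ψ − (n+1)^{−d} ind g‖² + (n+1)^{−d}⟨g, lap_c g⟩ = a‖ψ‖² − 2a(n+1)^{−d}⟨indᵀψ, g⟩ + (n+1)^{−d}⟨g, H g⟩`
(the two `‖ind g‖²` terms cancel; `H = torusOp`). [folklore] -/
theorem energy_expand (a : ℝ) (ψ : Tor M → ℝ) (g : Tor (fine (n + 1) M) → ℝ) :
    a * ((ψ - (1 / ((n : ℝ) + 1) ^ d) • (ind n M).mulVec g) ⬝ᵥ (ψ - (1 / ((n : ℝ) + 1) ^ d) • (ind n M).mulVec g))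
        + 1 / ((n : ℝ) + 1) ^ d * (g ⬝ᵥ (lap (coupling (fine (n + 1) M) (((n : ℝ) + 1) ^ 2))).mulVec g)
      = a * (ψ ⬝ᵥ ψ) - 2 * a / ((n : ℝ) + 1) ^ d * (((ind n M)ᵀ).mulVec ψ ⬝ᵥ g)
        + 1 / ((n : ℝ) + 1) ^ d * (g ⬝ᵥ (torusOp n M a).mulVec g) := by
  have hm : ((n : ℝ) + 1) ^ d ≠ 0 := by positivity
  rw [torusOp_form_eq]
  have h1 : ((ind n M)ᵀ).mulVec ψ ⬝ᵥ g = ψ ⬝ᵥ (ind n M).mulVec g := by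
    rw [Matrix.mulVec_transpose, Matrix.dotProduct_mulVec]
  rw [h1]
  set w := (ind n M).mulVec g with hw
  simp only [sub_dotProduct, dotProduct_sub, dotProduct_smul, smul_dotProduct, smul_eq_mul]
  rw [dotProduct_comm w ψ]
  field_simp
  ring

/-- the quadratic form of `K_eff`: `⟨ψ, K_eff ψ⟩ = a‖ψ‖² − (a²/(n+1)^d)⟨indᵀψ, G₀ indᵀψ⟩`. [folklore] -/
theorem Keff_form_eq (a : ℝ) (ψ : Tor M → ℝ) :
    ψ ⬝ᵥ (Keff n M a).mulVec ψ
      = a * (ψ ⬝ᵥ ψ) - a ^ 2 / ((n : ℝ) + 1) ^ d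
          * (((ind n M)ᵀ).mulVec ψ ⬝ᵥ (G0 n M a).mulVec (((ind n M)ᵀ).mulVec ψ)) := by
  rw [Keff, Matrix.sub_mulVec, Matrix.smul_mulVec, Matrix.smul_mulVec, Matrix.one_mulVec,
    dotProduct_sub, dotProduct_smul, dotProduct_smul, smul_eq_mul, smul_eq_mul, ← Matrix.mulVec_mulVec,
    ← Matrix.mulVec_mulVec, Matrix.dotProduct_mulVec ψ (ind n M), ← Matrix.mulVec_transpose]

/-- **EQUALITY AT THE MINIMISER** `g⋆ = a G₀ indᵀ ψ`:
`⟨ψ, K_eff ψ⟩ = a‖ψ − (n+1)^{−d} ind g⋆‖² + (n+1)^{−d}⟨g⋆, lap_c g⋆⟩`. [folklore] -/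
theorem Keff_form_eq_energy (h3 : ∀ μ, 3 ≤ fine (n + 1) M μ) {a : ℝ} (ha : 0 < a) (ψ : Tor M → ℝ) :
    ψ ⬝ᵥ (Keff n M a).mulVec ψ
      = a * ((ψ - (1 / ((n : ℝ) + 1) ^ d) • (ind n M).mulVec (a • (G0 n M a).mulVec (((ind n M)ᵀ).mulVec ψ)))
              ⬝ᵥ (ψ - (1 / ((n : ℝ) + 1) ^ d) • (ind n M).mulVec (a • (G0 n M a).mulVec (((ind n M)ᵀ).mulVec ψ))))
        + 1 / ((n : ℝ) + 1) ^ d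
            * ((a • (G0 n M a).mulVec (((ind n M)ᵀ).mulVec ψ))
                ⬝ᵥ (lap (coupling (fine (n + 1) M) (((n : ℝ) + 1) ^ 2))).mulVec
                    (a • (G0 n M a).mulVec (((ind n M)ᵀ).mulVec ψ))) := by
  have hm : ((n : ℝ) + 1) ^ d ≠ 0 := by positivity
  rw [energy_expand, Keff_form_eq]
  set u := ((ind n M)ᵀ).mulVec ψ with hu
  simp only [Matrix.mulVec_smul, torusOp_mulVec_G0 n M h3 ha, dotProduct_smul, smul_dotProduct, smul_eq_mul]
  rw [dotProduct_comm ((G0 n M a).mulVec u) u]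
  field_simp
  ring

/-- **THE VARIATIONAL PRINCIPLE**: for EVERY fine configuration `g`,
`⟨ψ, K_eff ψ⟩ ≤ a‖ψ − (n+1)^{−d} ind g‖² + (n+1)^{−d}⟨g, lap_c g⟩` — `½⟨ψ,K_eff ψ⟩` is the minimum over `g` of the fine
kinetic energy plus the block-spin penalty (the difference is `(n+1)^{−d}⟨g − g⋆, H (g − g⋆)⟩ ≥ 0`). [folklore] -/
theorem Keff_form_le_energy (h3 : ∀ μ, 3 ≤ fine (n + 1) M μ) {a : ℝ} (ha : 0 < a) (ψ : Tor M → ℝ)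
    (g : Tor (fine (n + 1) M) → ℝ) :
    ψ ⬝ᵥ (Keff n M a).mulVec ψ
      ≤ a * ((ψ - (1 / ((n : ℝ) + 1) ^ d) • (ind n M).mulVec g) ⬝ᵥ (ψ - (1 / ((n : ℝ) + 1) ^ d) • (ind n M).mulVec g))
        + 1 / ((n : ℝ) + 1) ^ d * (g ⬝ᵥ (lap (coupling (fine (n + 1) M) (((n : ℝ) + 1) ^ 2))).mulVec g) := by
  have hm : (0 : ℝ) < ((n : ℝ) + 1) ^ d := by positivity
  rw [energy_expand, Keff_form_eq]
  set u := ((ind n M)ᵀ).mulVec ψ with hu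
  set f₀ := (G0 n M a).mulVec u with hf₀
  -- positivity of `⟨(g − a f₀), H (g − a f₀)⟩`
  have hpos : 0 ≤ (g - a • f₀) ⬝ᵥ (torusOp n M a).mulVec (g - a • f₀) := by
    rw [torusOp_form_eq]
    exact add_nonneg (lap_form_nonneg n M _)
      (mul_nonneg (by positivity) (Finset.sum_nonneg fun i _ => mul_self_nonneg _))
  have hsym : f₀ ⬝ᵥ (torusOp n M a).mulVec g = u ⬝ᵥ g := by
    rw [Matrix.dotProduct_mulVec, ← Matrix.mulVec_transpose, torusOp_transpose, hf₀,
      torusOp_mulVec_G0 n M h3 ha]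
  have hexp : (g - a • f₀) ⬝ᵥ (torusOp n M a).mulVec (g - a • f₀)
      = g ⬝ᵥ (torusOp n M a).mulVec g - 2 * a * (u ⬝ᵥ g) + a ^ 2 * (u ⬝ᵥ f₀) := by
    rw [Matrix.mulVec_sub, Matrix.mulVec_smul, hf₀, torusOp_mulVec_G0 n M h3 ha, ← hf₀]
    simp only [sub_dotProduct, dotProduct_sub, dotProduct_smul, smul_dotProduct, smul_eq_mul]
    rw [hsym, dotProduct_comm g u, dotProduct_comm f₀ u]
    ring
  rw [hexp] at hpos
  have key : a * (ψ ⬝ᵥ ψ) - 2 * a / ((n : ℝ) + 1) ^ d * (u ⬝ᵥ g)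
        + 1 / ((n : ℝ) + 1) ^ d * (g ⬝ᵥ (torusOp n M a).mulVec g)
        - (a * (ψ ⬝ᵥ ψ) - a ^ 2 / ((n : ℝ) + 1) ^ d * (u ⬝ᵥ f₀))
      = 1 / ((n : ℝ) + 1) ^ d
          * (g ⬝ᵥ (torusOp n M a).mulVec g - 2 * a * (u ⬝ᵥ g) + a ^ 2 * (u ⬝ᵥ f₀)) := by
    ring
  have hnn : 0 ≤ 1 / ((n : ℝ) + 1) ^ d
      * (g ⬝ᵥ (torusOp n M a).mulVec g - 2 * a * (u ⬝ᵥ g) + a ^ 2 * (u ⬝ᵥ f₀)) :=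
    mul_nonneg (by positivity) hpos
  linarith

/-! ## §4  Uniform coercivity of `K_eff`; `ker K_eff = constants` -/

/-- **UNIFORM COERCIVITY OF THE EFFECTIVE KINETIC TERM**: for every mesh `η = 1/(n+1)`, every period vector with
`(n+1)M_μ ≥ 3`, every `a > 0` and every `ψ : Tor M → ℝ`,
`min(a/(8d), 1/2) · Σ_{b,μ}(ψ(b + e_μ) − ψ(b))² ≤ ⟨ψ, K_eff ψ⟩` — an `η`- and volume-free multiple of the unit
Laplacian bounds `K_eff` from below (and `⟨ψ,K_eff ψ⟩ ≤ a‖ψ‖²`, module 1). [folklore] -/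
theorem Keff_form_ge_dirichletT (h3 : ∀ μ, 3 ≤ fine (n + 1) M μ) {a : ℝ} (ha : 0 < a) (ψ : Tor M → ℝ) :
    min (a / (8 * d)) (1 / 2) * dirichletT M ψ ≤ ψ ⬝ᵥ (Keff n M a).mulVec ψ := by
  have hm : (0 : ℝ) < ((n : ℝ) + 1) ^ d := by positivity
  have hE := Keff_form_eq_energy n M h3 ha ψ
  set g := a • (G0 n M a).mulVec (((ind n M)ᵀ).mulVec ψ) with hg
  set φ := (1 / ((n : ℝ) + 1) ^ d) • (ind n M).mulVec g with hφ
  set c := min (a / (8 * d)) (1 / 2) with hc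
  -- (i) subadditivity
  have h1 : dirichletT M ψ ≤ 2 * dirichletT M (ψ - φ) + 2 * dirichletT M φ := by
    have h := dirichletT_add_le M (ψ - φ) φ
    rwa [sub_add_cancel] at h
  -- (ii) the fluctuation part is bounded by its norm
  have h2 : dirichletT M (ψ - φ) ≤ 4 * d * ((ψ - φ) ⬝ᵥ (ψ - φ)) := dirichletT_le_norm M (ψ - φ)
  -- (iii) the block-averaged part carries at most the fine energy
  have h3' : dirichletT M φ
      ≤ 1 / ((n : ℝ) + 1) ^ d * (g ⬝ᵥ (lap (coupling (fine (n + 1) M) (((n : ℝ) + 1) ^ 2))).mulVec g) := by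
    rw [hφ, dirichletT_smul]
    calc (1 / ((n : ℝ) + 1) ^ d) ^ 2 * dirichletT M ((ind n M).mulVec g)
        ≤ (1 / ((n : ℝ) + 1) ^ d) ^ 2
            * (((n : ℝ) + 1) ^ d * ((n : ℝ) + 1) ^ 2 * dirichletT (fine (n + 1) M) g) :=
          mul_le_mul_of_nonneg_left (dirichletT_ind_le n M g) (by positivity)
      _ = 1 / ((n : ℝ) + 1) ^ d * (((n : ℝ) + 1) ^ 2 * dirichletT (fine (n + 1) M) g) := by
          field_simp
      _ ≤ 1 / ((n : ℝ) + 1) ^ d * (g ⬝ᵥ (lap (coupling (fine (n + 1) M) (((n : ℝ) + 1) ^ 2))).mulVec g) :=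
          mul_le_mul_of_nonneg_left (lap_form_ge_dirichletT n M h3 g) (by positivity)
  -- (iv) constants
  have hc0 : 0 ≤ c := le_min (div_nonneg ha.le (by positivity)) (by norm_num)
  have hca : c * (8 * d) ≤ a := by
    rcases Nat.eq_zero_or_pos d with hd | hd
    · rw [hd]; simp; exact ha.le
    · have hd' : (0 : ℝ) < 8 * d := by positivity
      calc c * (8 * d) ≤ a / (8 * d) * (8 * d) := mul_le_mul_of_nonneg_right (min_le_left _ _) hd'.le
        _ = a := div_mul_cancel₀ a hd'.ne'
  have hc2 : 2 * c ≤ 1 := by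
    have h := min_le_right (a / (8 * d)) (1 / 2)
    linarith
  have hP : 0 ≤ (ψ - φ) ⬝ᵥ (ψ - φ) := Finset.sum_nonneg fun i _ => mul_self_nonneg _
  have hL : 0 ≤ 1 / ((n : ℝ) + 1) ^ d
      * (g ⬝ᵥ (lap (coupling (fine (n + 1) M) (((n : ℝ) + 1) ^ 2))).mulVec g) :=
    mul_nonneg (by positivity) (lap_form_nonneg n M g)
  rw [hE]
  calc c * dirichletT M ψ
      ≤ c * (2 * (4 * d * ((ψ - φ) ⬝ᵥ (ψ - φ)))
          + 2 * (1 / ((n : ℝ) + 1) ^ d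
              * (g ⬝ᵥ (lap (coupling (fine (n + 1) M) (((n : ℝ) + 1) ^ 2))).mulVec g))) :=
        mul_le_mul_of_nonneg_left (h1.trans (by linarith)) hc0
    _ = c * (8 * d) * ((ψ - φ) ⬝ᵥ (ψ - φ))
          + 2 * c * (1 / ((n : ℝ) + 1) ^ d
              * (g ⬝ᵥ (lap (coupling (fine (n + 1) M) (((n : ℝ) + 1) ^ 2))).mulVec g)) := by ring
    _ ≤ a * ((ψ - φ) ⬝ᵥ (ψ - φ))
          + 1 * (1 / ((n : ℝ) + 1) ^ d
              * (g ⬝ᵥ (lap (coupling (fine (n + 1) M) (((n : ℝ) + 1) ^ 2))).mulVec g)) :=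
        add_le_add (mul_le_mul_of_nonneg_right hca hP) (mul_le_mul_of_nonneg_right hc2 hL)
    _ = _ := by rw [one_mul]

/-- **`ker K_eff = constants`**: `⟨ψ, K_eff ψ⟩ = 0` forces `ψ` to be constant (with module 1's `Keff_mulVec_one`,
constants are exactly the kernel — the zero mode of a massless kinetic term and nothing else). [folklore] -/
theorem Keff_ker_const (h3 : ∀ μ, 3 ≤ fine (n + 1) M μ) {a : ℝ} (ha : 0 < a) {ψ : Tor M → ℝ}
    (h0 : ψ ⬝ᵥ (Keff n M a).mulVec ψ = 0) (b b' : Tor M) : ψ b = ψ b' := by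
  rcases Nat.eq_zero_or_pos d with hd | hd
  · subst hd
    exact congrArg ψ (Subsingleton.elim b b')
  · have hc : 0 < min (a / (8 * d)) (1 / 2) := lt_min (by positivity) (by norm_num)
    have h := Keff_form_ge_dirichletT n M h3 ha ψ
    rw [h0] at h
    have hE : dirichletT M ψ = 0 :=
      le_antisymm (le_of_mul_le_mul_left (h.trans_eq (mul_zero _).symm) hc) (dirichletT_nonneg M ψ)
    exact eq_of_dirichletT_eq_zero M ψ hE b b'

/-- `K_eff ψ = 0 ⇒ ψ` constant (matrix-kernel form of `Keff_ker_const`). [folklore] -/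
theorem Keff_mulVec_eq_zero_const (h3 : ∀ μ, 3 ≤ fine (n + 1) M μ) {a : ℝ} (ha : 0 < a) {ψ : Tor M → ℝ}
    (h0 : (Keff n M a).mulVec ψ = 0) (b b' : Tor M) : ψ b = ψ b' :=
  Keff_ker_const n M h3 ha (by rw [h0, dotProduct_zero]) b b'

/-- **TWO-SIDED, UNIFORM**: `min(a/(8d),1/2)·E₁(ψ) ≤ ⟨ψ, K_eff ψ⟩ ≤ a‖ψ‖²` for every mesh and volume. [folklore] -/
theorem Keff_form_two_sided (h3 : ∀ μ, 3 ≤ fine (n + 1) M μ) {a : ℝ} (ha : 0 < a) (ψ : Tor M → ℝ) :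
    min (a / (8 * d)) (1 / 2) * dirichletT M ψ ≤ ψ ⬝ᵥ (Keff n M a).mulVec ψ
      ∧ ψ ⬝ᵥ (Keff n M a).mulVec ψ ≤ a * (ψ ⬝ᵥ ψ) :=
  ⟨Keff_form_ge_dirichletT n M h3 ha ψ, Keff_form_le n M h3 ha ψ⟩

end

/-! ## Sanity (d = 4) -/

section Sanity
open B5Prop11Plancherel (fine)

/-- the coercivity constant at `d = 4`, `a = 1` is `1/32`. [folklore] -/
example : min ((1 : ℝ) / (8 * (4 : ℕ))) (1 / 2) = 1 / 32 := by norm_num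

/-- non-vacuity of the period hypothesis at `d = 4`: mesh `η = 1` (`n = 0`) on the `3⁴` torus. [folklore] -/
example : ∀ μ : Fin 4, 3 ≤ fine (0 + 1) (fun _ => 3) μ := by
  intro μ; show 3 ≤ (0 + 1) * 3; norm_num

end Sanity

end Literature.MathematicalPhysics.QuantumFieldTheory.Balaban1983to89.Beta.EffectiveKernelCoercive
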